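import Summits.NavierStokesRegularity.NavierStokesRegularity.Theorems.ExtremiserTransienceNearExtremalTransienceExtremiserLiouvilleConstantSpeedBlowDownWindow
import Mathlib.Analysis.Normed.Module.WeakDual
import Mathlib.MeasureTheory.Measure.SeparableMeasure
import Mathlib.MeasureTheory.Function.L2Space
import HarnessLib

/-!
# Crux `ExtremiserTransience.NearExtremalTransience` (stmt-NavierStokesRegularity-21883), line `extremiser_liouville`,
# stub K1b — EXTRACTION OF WEAK `L²_loc` LIMITS (so that the blow-down kills need no limit object as input)

`--supports stmt-NavierStokesRegularity-21883` (helper).  Author: prover seat `ns-el-k1b` (g6).  The blow-down theorems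
(`blowDown_weakLimit_ae_eq_zero`, `blowDown_window_false_of_H1bound`) take a pairings-limit `U` of the blow-downs as INPUT.  Here it
is CONSTRUCTED: a sequence of continuous fields `Fₙ` with `∫⁻_{B_L}‖Fₙ‖ₑ² ≤ C·L` (`L ≥ 1`) has a subsequence whose pairings with
every continuous compactly supported `Φ` converge to those of a locally square-integrable `U` with the same growth.  Device: all
`Fₙ` lie in a fixed ball of the separable Hilbert space `L²(ℝ³, w dx; ℝ³)` for the dyadic weight `w = Σₖ 4^{-k}C⁻¹ 𝟙_{B(0,2^k)}` (written out in every statement; no definitions are introduced);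
sequential Banach–Alaoglu (Mathlib `WeakDual.isSeqCompact_closedBall`, transported by Riesz) gives a weak limit there; pairings
with `Φ ∈ C_c` are inner products with `Φ/w`; the growth `∫_{B_L}‖U‖² ≤ 16 C L²` of `U` is read off the weight.

* `exists_strictMono_tendsto_real_inner` : weak sequential compactness of bounded sequences in a separable real Hilbert space;
* `exists_subseq_weakLimit_of_growth` : the extraction statement above.

WHAT THIS IS NOT: K1b is NOT proved; nothing here proves NS regularity. [folklore]
-/

noncomputable section

open Set Filter Topology MeasureTheory Metric Function
open scoped ENNReal NNReal Topology InnerProductSpace RealInnerProductSpace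
open Literature.Analysis.FluidPDE Literature.Analysis

namespace Summit.NavierStokesRegularity.NavierStokesRegularity.Theorems

-- the problem directory repeats the summit name (`NavierStokesRegularity/NavierStokesRegularity`)
set_option linter.dupNamespace false

namespace ExtremiserLiouville

open DepletionLadder.KStar DepletionLadder.KStar.HalfSpace

/-- **Weak sequential compactness in a separable real Hilbert space**: a bounded sequence has a weakly convergent subsequence
(sequential Banach–Alaoglu in the weak-* dual, transported by the Riesz isometry; cf. the complex version
`RusinSverak.exists_strictMono_tendsto_inner`). [folklore] -/
theorem exists_strictMono_tendsto_real_inner {H : Type*} [NormedAddCommGroup H] [InnerProductSpace ℝ H] [CompleteSpace H]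
    [TopologicalSpace.SeparableSpace H] (x : ℕ → H) {R : ℝ} (hx : ∀ n, ‖x n‖ ≤ R) :
    ∃ (a : H) (φ : ℕ → ℕ), StrictMono φ ∧ ‖a‖ ≤ R ∧ ∀ w : H, Tendsto (fun n => ⟪x (φ n), w⟫_ℝ) atTop (𝓝 ⟪a, w⟫_ℝ) := by
  set ψ : ℕ → WeakDual ℝ H := fun n => StrongDual.toWeakDual (InnerProductSpace.toDual ℝ H (x n)) with hψ
  have hmem : ∀ n, ψ n ∈ WeakDual.toStrongDual ⁻¹' Metric.closedBall (0 : StrongDual ℝ H) R := by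
    intro n
    simp only [Set.mem_preimage, Metric.mem_closedBall, dist_zero_right, hψ, StrongDual.toStrongDual_toWeakDual,
      LinearIsometryEquiv.norm_map]
    exact hx n
  obtain ⟨ℓ, hℓ, φ, hφ, hlim⟩ := (WeakDual.isSeqCompact_closedBall ℝ H 0 R) hmem
  refine ⟨(InnerProductSpace.toDual ℝ H).symm (WeakDual.toStrongDual ℓ), φ, hφ, ?_, ?_⟩
  · simp only [Set.mem_preimage, Metric.mem_closedBall, dist_zero_right] at hℓ
    simpa using hℓ
  · intro w
    rw [tendsto_iff_forall_eval_tendsto_topDualPairing] at hlim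
    have h := hlim w
    simp only [topDualPairing_apply, comp_apply, hψ, StrongDual.toWeakDual] at h
    rw [InnerProductSpace.toDual_symm_apply]
    exact h

/-! ## The weight -/

/-- The weight is measurable. [folklore] -/
theorem measurable_growthWeight (C : ℝ) : Measurable (fun x : E3 => ∑' k : ℕ, (ball (0 : E3) ((2 : ℝ) ^ k)).indicator (fun _ => ENNReal.ofReal ((4 : ℝ)⁻¹ ^ k / C)) x) := by
  simp_rw [ENNReal.tsum_eq_iSup_sum]
  exact Measurable.iSup fun s => Finset.measurable_sum s fun i _ => measurable_const.indicator measurableSet_ball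

/-- The weight is bounded: `w ≤ (4/3)/C`. [folklore] -/
theorem growthWeight_le {C : ℝ} (hC : 0 < C) (x : E3) : (∑' k : ℕ, (ball (0 : E3) ((2 : ℝ) ^ k)).indicator (fun _ => ENNReal.ofReal ((4 : ℝ)⁻¹ ^ k / C)) x) ≤ ENNReal.ofReal ((1 - 4⁻¹)⁻¹ / C) := by
  calc ∑' k : ℕ, (ball (0 : E3) ((2 : ℝ) ^ k)).indicator (fun _ => ENNReal.ofReal ((4 : ℝ)⁻¹ ^ k / C)) x
      ≤ ∑' k : ℕ, ENNReal.ofReal ((4 : ℝ)⁻¹ ^ k / C) := ENNReal.tsum_le_tsum fun k => indicator_le_self _ _ x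
    _ = ENNReal.ofReal ((1 - 4⁻¹)⁻¹ / C) := by
        have hs : Summable fun k : ℕ => (4 : ℝ)⁻¹ ^ k / C :=
          (summable_geometric_of_lt_one (by norm_num) (by norm_num)).div_const C
        rw [← ENNReal.ofReal_tsum_of_nonneg (fun k => by positivity) hs, tsum_div_const,
          tsum_geometric_of_lt_one (by norm_num) (by norm_num)]

/-- On `B(0,2^k)` the weight is at least `cₖ`. [folklore] -/
theorem growthWeight_ge {C : ℝ} (k : ℕ) {x : E3} (hx : x ∈ ball (0 : E3) ((2 : ℝ) ^ k)) :
    ENNReal.ofReal ((4 : ℝ)⁻¹ ^ k / C) ≤ (∑' k : ℕ, (ball (0 : E3) ((2 : ℝ) ^ k)).indicator (fun _ => ENNReal.ofReal ((4 : ℝ)⁻¹ ^ k / C)) x) := by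
  calc ENNReal.ofReal ((4 : ℝ)⁻¹ ^ k / C)
      = (ball (0 : E3) ((2 : ℝ) ^ k)).indicator (fun _ => ENNReal.ofReal ((4 : ℝ)⁻¹ ^ k / C)) x := by
        rw [indicator_of_mem hx]
    _ ≤ ∑' j : ℕ, (ball (0 : E3) ((2 : ℝ) ^ j)).indicator (fun _ => ENNReal.ofReal ((4 : ℝ)⁻¹ ^ j / C)) x :=
        ENNReal.le_tsum k

/-- The weight is positive everywhere. [folklore] -/
theorem growthWeight_pos {C : ℝ} (hC : 0 < C) (x : E3) : 0 < (∑' k : ℕ, (ball (0 : E3) ((2 : ℝ) ^ k)).indicator (fun _ => ENNReal.ofReal ((4 : ℝ)⁻¹ ^ k / C)) x) := by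
  obtain ⟨k, hk⟩ := exists_nat_gt ‖x‖
  have h2 : (k : ℝ) ≤ (2 : ℝ) ^ k := by exact_mod_cast (Nat.lt_two_pow_self).le
  have hx : x ∈ ball (0 : E3) ((2 : ℝ) ^ k) := by rw [mem_ball_zero_iff]; linarith
  exact lt_of_lt_of_le (ENNReal.ofReal_pos.2 (by positivity)) (growthWeight_ge k hx)

/-- **Weighted mass from growth**: `∫⁻_{B_L}‖F‖ₑ² ≤ C L` for `L ≥ 1` ⇒ `∫⁻ w ‖F‖ₑ² ≤ 2`. [folklore] -/
theorem lintegral_growthWeight_mul_le {C : ℝ} (hC : 0 < C) {F : E3 → E3} (hF : AEStronglyMeasurable F volume)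
    (hbd : ∀ L : ℝ, 1 ≤ L → ∫⁻ x in ball (0 : E3) L, ‖F x‖ₑ ^ 2 ≤ ENNReal.ofReal (C * L)) :
    ∫⁻ x, (∑' k : ℕ, (ball (0 : E3) ((2 : ℝ) ^ k)).indicator (fun _ => ENNReal.ofReal ((4 : ℝ)⁻¹ ^ k / C)) x) * ‖F x‖ₑ ^ 2 ≤ 2 := by
  have hmeas : ∀ k : ℕ, AEMeasurable (fun x => (ball (0 : E3) ((2 : ℝ) ^ k)).indicator
      (fun _ => ENNReal.ofReal ((4 : ℝ)⁻¹ ^ k / C)) x * ‖F x‖ₑ ^ 2) volume := fun k =>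
    ((measurable_const.indicator measurableSet_ball).aemeasurable).mul (hF.aemeasurable.enorm.pow_const 2)
  have h1 : ∫⁻ x, (∑' k : ℕ, (ball (0 : E3) ((2 : ℝ) ^ k)).indicator (fun _ => ENNReal.ofReal ((4 : ℝ)⁻¹ ^ k / C)) x) * ‖F x‖ₑ ^ 2 = ∑' k : ℕ, ∫⁻ x, (ball (0 : E3) ((2 : ℝ) ^ k)).indicator
      (fun _ => ENNReal.ofReal ((4 : ℝ)⁻¹ ^ k / C)) x * ‖F x‖ₑ ^ 2 := by
    simp_rw [← ENNReal.tsum_mul_right]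
    exact lintegral_tsum hmeas
  rw [h1]
  have h2 : ∀ k : ℕ, ∫⁻ x, (ball (0 : E3) ((2 : ℝ) ^ k)).indicator
      (fun _ => ENNReal.ofReal ((4 : ℝ)⁻¹ ^ k / C)) x * ‖F x‖ₑ ^ 2 ≤ ENNReal.ofReal ((2 : ℝ)⁻¹ ^ k) := by
    intro k
    have he : (fun x => (ball (0 : E3) ((2 : ℝ) ^ k)).indicator
        (fun _ => ENNReal.ofReal ((4 : ℝ)⁻¹ ^ k / C)) x * ‖F x‖ₑ ^ 2) =
        (ball (0 : E3) ((2 : ℝ) ^ k)).indicator (fun x => ENNReal.ofReal ((4 : ℝ)⁻¹ ^ k / C) * ‖F x‖ₑ ^ 2) := by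
      funext x
      by_cases hx : x ∈ ball (0 : E3) ((2 : ℝ) ^ k)
      · rw [indicator_of_mem hx, indicator_of_mem hx]
      · rw [indicator_of_notMem hx, indicator_of_notMem hx, zero_mul]
    rw [he, lintegral_indicator measurableSet_ball, lintegral_const_mul' _ _ ENNReal.ofReal_ne_top]
    have hk1 : (1 : ℝ) ≤ (2 : ℝ) ^ k := one_le_pow₀ (by norm_num)
    calc ENNReal.ofReal ((4 : ℝ)⁻¹ ^ k / C) * ∫⁻ x in ball (0 : E3) ((2 : ℝ) ^ k), ‖F x‖ₑ ^ 2
        ≤ ENNReal.ofReal ((4 : ℝ)⁻¹ ^ k / C) * ENNReal.ofReal (C * (2 : ℝ) ^ k) := mul_le_mul' le_rfl (hbd _ hk1)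
      _ = ENNReal.ofReal ((2 : ℝ)⁻¹ ^ k) := by
          rw [← ENNReal.ofReal_mul (by positivity)]
          congr 1
          rw [div_mul_eq_mul_div, mul_comm C, ← mul_assoc, mul_div_assoc, div_self hC.ne', mul_one, ← mul_pow]
          norm_num
  calc ∑' k : ℕ, ∫⁻ x, (ball (0 : E3) ((2 : ℝ) ^ k)).indicator
        (fun _ => ENNReal.ofReal ((4 : ℝ)⁻¹ ^ k / C)) x * ‖F x‖ₑ ^ 2
      ≤ ∑' k : ℕ, ENNReal.ofReal ((2 : ℝ)⁻¹ ^ k) := ENNReal.tsum_le_tsum h2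
    _ = 2 := by
        rw [← ENNReal.ofReal_tsum_of_nonneg (fun k => by positivity) (summable_geometric_of_lt_one (by norm_num) (by norm_num)),
          tsum_geometric_inv_two]
        simp

/-! ## The weighted `L²` space -/

/-- `w dx` is s-finite. [folklore] -/
theorem sFinite_weightedVolume (C : ℝ) : SFinite (((volume : Measure E3).withDensity (fun x : E3 => ∑' k : ℕ, (ball (0 : E3) ((2 : ℝ) ^ k)).indicator (fun _ => ENNReal.ofReal ((4 : ℝ)⁻¹ ^ k / C)) x))) := by infer_instance

/-- `volume ≪ w dx` (the weight is positive). [folklore] -/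
theorem volume_absolutelyContinuous_weightedVolume {C : ℝ} (hC : 0 < C) :
    (volume : Measure E3) ≪ ((volume : Measure E3).withDensity (fun x : E3 => ∑' k : ℕ, (ball (0 : E3) ((2 : ℝ) ^ k)).indicator (fun _ => ENNReal.ofReal ((4 : ℝ)⁻¹ ^ k / C)) x)) :=
  withDensity_absolutelyContinuous' (measurable_growthWeight C).aemeasurable
    (Eventually.of_forall fun x => (growthWeight_pos hC x).ne')

/-- The weight is finite everywhere. [folklore] -/
theorem growthWeight_lt_top {C : ℝ} (hC : 0 < C) (x : E3) : (∑' k : ℕ, (ball (0 : E3) ((2 : ℝ) ^ k)).indicator (fun _ => ENNReal.ofReal ((4 : ℝ)⁻¹ ^ k / C)) x) < ⊤ :=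
  lt_of_le_of_lt (growthWeight_le hC x) ENNReal.ofReal_lt_top

/-- Lower integral against `w dx`. [folklore] -/
theorem lintegral_weightedVolume (C : ℝ) {g : E3 → ℝ≥0∞} (hg : Measurable g) :
    ∫⁻ x, g x ∂(((volume : Measure E3).withDensity (fun x : E3 => ∑' k : ℕ, (ball (0 : E3) ((2 : ℝ) ^ k)).indicator (fun _ => ENNReal.ofReal ((4 : ℝ)⁻¹ ^ k / C)) x))) = ∫⁻ x, (∑' k : ℕ, (ball (0 : E3) ((2 : ℝ) ^ k)).indicator (fun _ => ENNReal.ofReal ((4 : ℝ)⁻¹ ^ k / C)) x) * g x := by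
  rw [lintegral_withDensity_eq_lintegral_mul _ (measurable_growthWeight C) hg]
  rfl

/-- Bochner integral against `w dx`. [folklore] -/
theorem integral_weightedVolume {C : ℝ} (hC : 0 < C) (g : E3 → ℝ) :
    ∫ x, g x ∂(((volume : Measure E3).withDensity (fun x : E3 => ∑' k : ℕ, (ball (0 : E3) ((2 : ℝ) ^ k)).indicator (fun _ => ENNReal.ofReal ((4 : ℝ)⁻¹ ^ k / C)) x))) = ∫ x, ((∑' k : ℕ, (ball (0 : E3) ((2 : ℝ) ^ k)).indicator (fun _ => ENNReal.ofReal ((4 : ℝ)⁻¹ ^ k / C)) x)).toReal * g x := by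
  rw [integral_withDensity_eq_integral_toReal_smul (measurable_growthWeight C)
    (Eventually.of_forall fun x => growthWeight_lt_top hC x)]
  rfl

/-- `w dx ≪ volume`. [folklore] -/
theorem weightedVolume_absolutelyContinuous (C : ℝ) : ((volume : Measure E3).withDensity (fun x : E3 => ∑' k : ℕ, (ball (0 : E3) ((2 : ℝ) ^ k)).indicator (fun _ => ENNReal.ofReal ((4 : ℝ)⁻¹ ^ k / C)) x)) ≪ (volume : Measure E3) :=
  withDensity_absolutelyContinuous _ _

/-- A field with `∫⁻_{B_L}‖F‖ₑ² ≤ C L` (`L ≥ 1`) lies in `L²(w dx)` with `eLpNorm ≤ 2`. [folklore] -/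
theorem memLp_weightedVolume_of_growth {C : ℝ} (hC : 0 < C) {F : E3 → E3} (hF : AEStronglyMeasurable F volume)
    (hbd : ∀ L : ℝ, 1 ≤ L → ∫⁻ x in ball (0 : E3) L, ‖F x‖ₑ ^ 2 ≤ ENNReal.ofReal (C * L)) :
    MemLp F 2 (((volume : Measure E3).withDensity (fun x : E3 => ∑' k : ℕ, (ball (0 : E3) ((2 : ℝ) ^ k)).indicator (fun _ => ENNReal.ofReal ((4 : ℝ)⁻¹ ^ k / C)) x))) ∧ eLpNorm F 2 (((volume : Measure E3).withDensity (fun x : E3 => ∑' k : ℕ, (ball (0 : E3) ((2 : ℝ) ^ k)).indicator (fun _ => ENNReal.ofReal ((4 : ℝ)⁻¹ ^ k / C)) x))) ≤ 2 := by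
  have hFw : AEStronglyMeasurable F (((volume : Measure E3).withDensity (fun x : E3 => ∑' k : ℕ, (ball (0 : E3) ((2 : ℝ) ^ k)).indicator (fun _ => ENNReal.ofReal ((4 : ℝ)⁻¹ ^ k / C)) x))) := hF.mono_ac (weightedVolume_absolutelyContinuous C)
  have h2 : eLpNorm F 2 (((volume : Measure E3).withDensity (fun x : E3 => ∑' k : ℕ, (ball (0 : E3) ((2 : ℝ) ^ k)).indicator (fun _ => ENNReal.ofReal ((4 : ℝ)⁻¹ ^ k / C)) x))) ≤ 2 := by
    have hsq : eLpNorm F 2 (((volume : Measure E3).withDensity (fun x : E3 => ∑' k : ℕ, (ball (0 : E3) ((2 : ℝ) ^ k)).indicator (fun _ => ENNReal.ofReal ((4 : ℝ)⁻¹ ^ k / C)) x))) ^ 2 ≤ 2 := by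
      rw [eLpNorm_two_pow_two]
      -- `∫⁻ ‖F‖ₑ² d(w dx) = ∫⁻ w ‖F‖ₑ²` (a.e.-measurable version)
      obtain ⟨G, hGm, hFG⟩ := hF
      have hae : (fun x => ‖F x‖ₑ ^ 2) =ᵐ[((volume : Measure E3).withDensity (fun x : E3 => ∑' k : ℕ, (ball (0 : E3) ((2 : ℝ) ^ k)).indicator (fun _ => ENNReal.ofReal ((4 : ℝ)⁻¹ ^ k / C)) x))] fun x => ‖G x‖ₑ ^ 2 := by
        filter_upwards [(weightedVolume_absolutelyContinuous C).ae_le hFG] with x hx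
        rw [hx]
      rw [lintegral_congr_ae hae, lintegral_weightedVolume C (hGm.measurable.enorm.pow_const 2)]
      have hbd' : ∀ L : ℝ, 1 ≤ L → ∫⁻ x in ball (0 : E3) L, ‖G x‖ₑ ^ 2 ≤ ENNReal.ofReal (C * L) := by
        intro L hL
        have hae' : (fun x => ‖G x‖ₑ ^ 2) =ᵐ[volume.restrict (ball (0 : E3) L)] fun x => ‖F x‖ₑ ^ 2 := by
          filter_upwards [ae_restrict_of_ae hFG] with x hx
          rw [hx]
        rw [lintegral_congr_ae hae']
        exact hbd L hL
      exact lintegral_growthWeight_mul_le hC hGm.aestronglyMeasurable hbd'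
    calc eLpNorm F 2 (((volume : Measure E3).withDensity (fun x : E3 => ∑' k : ℕ, (ball (0 : E3) ((2 : ℝ) ^ k)).indicator (fun _ => ENNReal.ofReal ((4 : ℝ)⁻¹ ^ k / C)) x))) = (eLpNorm F 2 (((volume : Measure E3).withDensity (fun x : E3 => ∑' k : ℕ, (ball (0 : E3) ((2 : ℝ) ^ k)).indicator (fun _ => ENNReal.ofReal ((4 : ℝ)⁻¹ ^ k / C)) x))) ^ 2) ^ (1 / (2 : ℝ)) := by
          rw [← ENNReal.rpow_natCast, ← ENNReal.rpow_mul]; norm_num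
      _ ≤ (2 : ℝ≥0∞) ^ (1 / (2 : ℝ)) := ENNReal.rpow_le_rpow hsq (by norm_num)
      _ ≤ (2 : ℝ≥0∞) ^ (1 : ℝ) := ENNReal.rpow_le_rpow_of_exponent_le (by norm_num) (by norm_num)
      _ = 2 := ENNReal.rpow_one _
  exact ⟨⟨hFw, lt_of_le_of_lt h2 ENNReal.ofNat_lt_top⟩, h2⟩

/-- **Inner products in `L²(w dx)` are weighted pairings**: `⟪toLp f, toLp g⟫ = ∫ w ⟪f, g⟫ dx`. [folklore] -/
theorem inner_toLp_weightedVolume {C : ℝ} (hC : 0 < C) {f g : E3 → E3} (hf : MemLp f 2 (((volume : Measure E3).withDensity (fun x : E3 => ∑' k : ℕ, (ball (0 : E3) ((2 : ℝ) ^ k)).indicator (fun _ => ENNReal.ofReal ((4 : ℝ)⁻¹ ^ k / C)) x))))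
    (hg : MemLp g 2 (((volume : Measure E3).withDensity (fun x : E3 => ∑' k : ℕ, (ball (0 : E3) ((2 : ℝ) ^ k)).indicator (fun _ => ENNReal.ofReal ((4 : ℝ)⁻¹ ^ k / C)) x)))) :
    ⟪hf.toLp f, hg.toLp g⟫_ℝ = ∫ x, ((∑' k : ℕ, (ball (0 : E3) ((2 : ℝ) ^ k)).indicator (fun _ => ENNReal.ofReal ((4 : ℝ)⁻¹ ^ k / C)) x)).toReal * ⟪f x, g x⟫_ℝ := by
  rw [MeasureTheory.L2.inner_def, ← integral_weightedVolume hC]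
  refine integral_congr_ae ?_
  filter_upwards [hf.coeFn_toLp, hg.coeFn_toLp] with x hfx hgx
  rw [hfx, hgx]

/-- **Test elements**: for `Ψ` measurable, bounded, supported in `B(0, K+1)`, the field `w⁻¹Ψ` is in `L²(w dx)` and
`∫ w ⟪f, w⁻¹Ψ⟫ = ∫ ⟪f, Ψ⟫`. [folklore] -/
theorem memLp_invWeight_smul {C : ℝ} (hC : 0 < C) {Ψ : E3 → E3} (hΨ : AEStronglyMeasurable Ψ volume) (K : ℕ)
    (hsupp : ∀ x, x ∉ ball (0 : E3) ((2 : ℝ) ^ K) → Ψ x = 0)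
    (hΨ2 : ∫⁻ x in ball (0 : E3) ((2 : ℝ) ^ K), ‖Ψ x‖ₑ ^ 2 < ⊤) :
    MemLp (fun x => ((∑' k : ℕ, (ball (0 : E3) ((2 : ℝ) ^ k)).indicator (fun _ => ENNReal.ofReal ((4 : ℝ)⁻¹ ^ k / C)) x)).toReal⁻¹ • Ψ x) 2 (((volume : Measure E3).withDensity (fun x : E3 => ∑' k : ℕ, (ball (0 : E3) ((2 : ℝ) ^ k)).indicator (fun _ => ENNReal.ofReal ((4 : ℝ)⁻¹ ^ k / C)) x))) := by
  set cK : ℝ := (4 : ℝ)⁻¹ ^ K / C with hcK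
  have hcK0 : 0 < cK := by positivity
  have hwm : Measurable fun x => ((∑' k : ℕ, (ball (0 : E3) ((2 : ℝ) ^ k)).indicator (fun _ => ENNReal.ofReal ((4 : ℝ)⁻¹ ^ k / C)) x)).toReal⁻¹ := (measurable_growthWeight C).ennreal_toReal.inv
  have hmeas : AEStronglyMeasurable (fun x => ((∑' k : ℕ, (ball (0 : E3) ((2 : ℝ) ^ k)).indicator (fun _ => ENNReal.ofReal ((4 : ℝ)⁻¹ ^ k / C)) x)).toReal⁻¹ • Ψ x) (((volume : Measure E3).withDensity (fun x : E3 => ∑' k : ℕ, (ball (0 : E3) ((2 : ℝ) ^ k)).indicator (fun _ => ENNReal.ofReal ((4 : ℝ)⁻¹ ^ k / C)) x))) :=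
    (hwm.aestronglyMeasurable.smul hΨ).mono_ac (weightedVolume_absolutelyContinuous C)
  refine ⟨hmeas, ?_⟩
  -- `∫⁻ w ‖w⁻¹Ψ‖ₑ² ≤ cK⁻¹ ∫⁻_{B_{K+1}} ‖Ψ‖ₑ² < ⊤`
  have hsq : eLpNorm (fun x => ((∑' k : ℕ, (ball (0 : E3) ((2 : ℝ) ^ k)).indicator (fun _ => ENNReal.ofReal ((4 : ℝ)⁻¹ ^ k / C)) x)).toReal⁻¹ • Ψ x) 2 (((volume : Measure E3).withDensity (fun x : E3 => ∑' k : ℕ, (ball (0 : E3) ((2 : ℝ) ^ k)).indicator (fun _ => ENNReal.ofReal ((4 : ℝ)⁻¹ ^ k / C)) x))) ^ 2 < ⊤ := by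
    rw [eLpNorm_two_pow_two]
    obtain ⟨G, hGm, hΨG⟩ := hΨ
    have hae : (fun x => ‖((∑' k : ℕ, (ball (0 : E3) ((2 : ℝ) ^ k)).indicator (fun _ => ENNReal.ofReal ((4 : ℝ)⁻¹ ^ k / C)) x)).toReal⁻¹ • Ψ x‖ₑ ^ 2) =ᵐ[((volume : Measure E3).withDensity (fun x : E3 => ∑' k : ℕ, (ball (0 : E3) ((2 : ℝ) ^ k)).indicator (fun _ => ENNReal.ofReal ((4 : ℝ)⁻¹ ^ k / C)) x))]
        fun x => ‖((∑' k : ℕ, (ball (0 : E3) ((2 : ℝ) ^ k)).indicator (fun _ => ENNReal.ofReal ((4 : ℝ)⁻¹ ^ k / C)) x)).toReal⁻¹ • G x‖ₑ ^ 2 := by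
      filter_upwards [(weightedVolume_absolutelyContinuous C).ae_le hΨG] with x hx
      rw [hx]
    have hm2 : Measurable (fun x => ((∑' k : ℕ, (ball (0 : E3) ((2 : ℝ) ^ k)).indicator (fun _ => ENNReal.ofReal ((4 : ℝ)⁻¹ ^ k / C)) x)).toReal⁻¹ • G x) := hwm.smul hGm.measurable
    rw [lintegral_congr_ae hae, lintegral_weightedVolume C (hm2.enorm.pow_const 2)]
    have hpt : ∀ᵐ x ∂(volume : Measure E3), (∑' k : ℕ, (ball (0 : E3) ((2 : ℝ) ^ k)).indicator (fun _ => ENNReal.ofReal ((4 : ℝ)⁻¹ ^ k / C)) x) * ‖((∑' k : ℕ, (ball (0 : E3) ((2 : ℝ) ^ k)).indicator (fun _ => ENNReal.ofReal ((4 : ℝ)⁻¹ ^ k / C)) x)).toReal⁻¹ • G x‖ₑ ^ 2 ≤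
        (ball (0 : E3) ((2 : ℝ) ^ K)).indicator (fun x => ENNReal.ofReal cK⁻¹ * ‖Ψ x‖ₑ ^ 2) x := by
      filter_upwards [hΨG] with x hx
      rw [← hx]
      by_cases hxB : x ∈ ball (0 : E3) ((2 : ℝ) ^ K)
      · rw [indicator_of_mem hxB, enorm_smul, mul_pow, ← mul_assoc]
        refine mul_le_mul' ?_ le_rfl
        have hw0 : 0 < ((∑' k : ℕ, (ball (0 : E3) ((2 : ℝ) ^ k)).indicator (fun _ => ENNReal.ofReal ((4 : ℝ)⁻¹ ^ k / C)) x)).toReal := ENNReal.toReal_pos (growthWeight_pos hC x).ne' (growthWeight_lt_top hC x).ne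
        have hwge : cK ≤ ((∑' k : ℕ, (ball (0 : E3) ((2 : ℝ) ^ k)).indicator (fun _ => ENNReal.ofReal ((4 : ℝ)⁻¹ ^ k / C)) x)).toReal := by
          have h := growthWeight_ge (C := C) K hxB
          rw [← hcK] at h
          exact (ENNReal.ofReal_le_iff_le_toReal (growthWeight_lt_top hC x).ne).1 h
        set t : ℝ := ((∑' k : ℕ, (ball (0 : E3) ((2 : ℝ) ^ k)).indicator (fun _ => ENNReal.ofReal ((4 : ℝ)⁻¹ ^ k / C)) x)).toReal with ht
        have hwt : (∑' k : ℕ, (ball (0 : E3) ((2 : ℝ) ^ k)).indicator (fun _ => ENNReal.ofReal ((4 : ℝ)⁻¹ ^ k / C)) x) = ENNReal.ofReal t := (ENNReal.ofReal_toReal (growthWeight_lt_top hC x).ne).symm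
        rw [Real.enorm_eq_ofReal (inv_nonneg.2 hw0.le), ← ENNReal.ofReal_pow (inv_nonneg.2 hw0.le), hwt,
          ← ENNReal.ofReal_mul hw0.le]
        refine ENNReal.ofReal_le_ofReal ?_
        rw [show t * (t⁻¹ ^ 2) = t⁻¹ by field_simp]
        exact inv_anti₀ hcK0 hwge
      · rw [indicator_of_notMem hxB, hsupp x hxB, smul_zero, enorm_zero]; simp
    calc ∫⁻ x, (∑' k : ℕ, (ball (0 : E3) ((2 : ℝ) ^ k)).indicator (fun _ => ENNReal.ofReal ((4 : ℝ)⁻¹ ^ k / C)) x) * ‖((∑' k : ℕ, (ball (0 : E3) ((2 : ℝ) ^ k)).indicator (fun _ => ENNReal.ofReal ((4 : ℝ)⁻¹ ^ k / C)) x)).toReal⁻¹ • G x‖ₑ ^ 2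
        ≤ ∫⁻ x, (ball (0 : E3) ((2 : ℝ) ^ K)).indicator (fun x => ENNReal.ofReal cK⁻¹ * ‖Ψ x‖ₑ ^ 2) x :=
          lintegral_mono_ae hpt
      _ = ENNReal.ofReal cK⁻¹ * ∫⁻ x in ball (0 : E3) ((2 : ℝ) ^ K), ‖Ψ x‖ₑ ^ 2 := by
          rw [lintegral_indicator measurableSet_ball, lintegral_const_mul' _ _ ENNReal.ofReal_ne_top]
      _ < ⊤ := ENNReal.mul_lt_top ENNReal.ofReal_lt_top hΨ2
  have h : eLpNorm (fun x => ((∑' k : ℕ, (ball (0 : E3) ((2 : ℝ) ^ k)).indicator (fun _ => ENNReal.ofReal ((4 : ℝ)⁻¹ ^ k / C)) x)).toReal⁻¹ • Ψ x) 2 (((volume : Measure E3).withDensity (fun x : E3 => ∑' k : ℕ, (ball (0 : E3) ((2 : ℝ) ^ k)).indicator (fun _ => ENNReal.ofReal ((4 : ℝ)⁻¹ ^ k / C)) x))) < ⊤ := by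
    by_contra hnot
    rw [not_lt, top_le_iff] at hnot
    rw [hnot, ENNReal.top_pow two_ne_zero] at hsq
    exact lt_irrefl _ hsq
  exact h

/-- The weighted pairing with `w⁻¹Ψ` is the plain pairing with `Ψ`. [folklore] -/
theorem weight_mul_inner_invWeight_smul {C : ℝ} (hC : 0 < C) (f Ψ : E3 → E3) (x : E3) :
    ((∑' k : ℕ, (ball (0 : E3) ((2 : ℝ) ^ k)).indicator (fun _ => ENNReal.ofReal ((4 : ℝ)⁻¹ ^ k / C)) x)).toReal * ⟪f x, ((∑' k : ℕ, (ball (0 : E3) ((2 : ℝ) ^ k)).indicator (fun _ => ENNReal.ofReal ((4 : ℝ)⁻¹ ^ k / C)) x)).toReal⁻¹ • Ψ x⟫_ℝ = ⟪f x, Ψ x⟫_ℝ := by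
  have hw0 : 0 < ((∑' k : ℕ, (ball (0 : E3) ((2 : ℝ) ^ k)).indicator (fun _ => ENNReal.ofReal ((4 : ℝ)⁻¹ ^ k / C)) x)).toReal :=
    ENNReal.toReal_pos (growthWeight_pos hC x).ne' (growthWeight_lt_top hC x).ne
  rw [real_inner_smul_right, ← mul_assoc, mul_inv_cancel₀ hw0.ne', one_mul]

/-- Lower integral against `w dx`, a.e.-measurable version. [folklore] -/
theorem lintegral_weightedVolume₀ (C : ℝ) {g : E3 → ℝ≥0∞} (hg : AEMeasurable g volume) :
    ∫⁻ x, g x ∂(((volume : Measure E3).withDensity (fun x : E3 => ∑' k : ℕ, (ball (0 : E3) ((2 : ℝ) ^ k)).indicator (fun _ => ENNReal.ofReal ((4 : ℝ)⁻¹ ^ k / C)) x))) = ∫⁻ x, (∑' k : ℕ, (ball (0 : E3) ((2 : ℝ) ^ k)).indicator (fun _ => ENNReal.ofReal ((4 : ℝ)⁻¹ ^ k / C)) x) * g x := by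
  rw [lintegral_withDensity_eq_lintegral_mul₀ (measurable_growthWeight C).aemeasurable hg]
  rfl

/-! ## Extraction -/

/-- **Extraction of a weak `L²_loc` limit.**  Continuous fields `Fₙ : ℝ³ → ℝ³` with `∫⁻_{B_L}‖Fₙ‖ₑ² ≤ C L` for all `n` and
`L ≥ 1` have a subsequence `F_{ns j}` and a locally square-integrable `U` (`∫⁻_{B_L}‖U‖ₑ² ≤ 16 C · L²` for `L ≥ 1`) with
`∫⟪F_{ns j}, Φ⟫ → ∫⟪U, Φ⟫` for every continuous compactly supported `Φ`. [folklore] -/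
theorem exists_subseq_weakLimit_of_growth {F : ℕ → E3 → E3} (hFc : ∀ n, Continuous (F n)) {C : ℝ} (hC : 0 < C)
    (hbd : ∀ n, ∀ L : ℝ, 1 ≤ L → ∫⁻ x in ball (0 : E3) L, ‖F n x‖ₑ ^ 2 ≤ ENNReal.ofReal (C * L)) :
    ∃ (U : E3 → E3) (ns : ℕ → ℕ), StrictMono ns ∧ AEStronglyMeasurable U volume ∧ LocallyIntegrable U volume ∧
      (∀ L : ℝ, 1 ≤ L → ∫⁻ x in ball (0 : E3) L, ‖U x‖ₑ ^ 2 ≤ ENNReal.ofReal (16 * C * L ^ (2 : ℝ))) ∧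
      ∀ Φ : E3 → E3, Continuous Φ → HasCompactSupport Φ →
        Tendsto (fun j => ∫ x, ⟪F (ns j) x, Φ x⟫_ℝ) atTop (𝓝 (∫ x, ⟪U x, Φ x⟫_ℝ)) := by
  -- the bounded sequence in `L²(w dx)`
  have hmem : ∀ n, MemLp (F n) 2 (((volume : Measure E3).withDensity (fun x : E3 => ∑' k : ℕ, (ball (0 : E3) ((2 : ℝ) ^ k)).indicator (fun _ => ENNReal.ofReal ((4 : ℝ)⁻¹ ^ k / C)) x))) ∧ eLpNorm (F n) 2 (((volume : Measure E3).withDensity (fun x : E3 => ∑' k : ℕ, (ball (0 : E3) ((2 : ℝ) ^ k)).indicator (fun _ => ENNReal.ofReal ((4 : ℝ)⁻¹ ^ k / C)) x))) ≤ 2 := fun n =>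
    memLp_weightedVolume_of_growth hC (hFc n).aestronglyMeasurable (hbd n)
  set xs : ℕ → Lp E3 2 (((volume : Measure E3).withDensity (fun x : E3 => ∑' k : ℕ, (ball (0 : E3) ((2 : ℝ) ^ k)).indicator (fun _ => ENNReal.ofReal ((4 : ℝ)⁻¹ ^ k / C)) x))) := fun n => (hmem n).1.toLp (F n) with hxs
  have hnorm : ∀ n, ‖xs n‖ ≤ 2 := by
    intro n
    rw [hxs]; dsimp only
    rw [Lp.norm_toLp]
    have h := (hmem n).2
    calc (eLpNorm (F n) 2 (((volume : Measure E3).withDensity (fun x : E3 => ∑' k : ℕ, (ball (0 : E3) ((2 : ℝ) ^ k)).indicator (fun _ => ENNReal.ofReal ((4 : ℝ)⁻¹ ^ k / C)) x)))).toReal ≤ (2 : ℝ≥0∞).toReal := ENNReal.toReal_mono ENNReal.ofNat_ne_top h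
      _ = 2 := by norm_num
  haveI : SFinite (((volume : Measure E3).withDensity (fun x : E3 => ∑' k : ℕ, (ball (0 : E3) ((2 : ℝ) ^ k)).indicator (fun _ => ENNReal.ofReal ((4 : ℝ)⁻¹ ^ k / C)) x))) := sFinite_weightedVolume C
  haveI : Fact ((2 : ℝ≥0∞) ≠ ⊤) := ⟨ENNReal.ofNat_ne_top⟩
  obtain ⟨a, ns, hns, ha2, hlim⟩ := exists_strictMono_tendsto_real_inner xs hnorm
  -- the limit as a function
  have haU : AEStronglyMeasurable (a : E3 → E3) volume :=
    (Lp.aestronglyMeasurable a).mono_ac (volume_absolutelyContinuous_weightedVolume hC)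
  have haM : MemLp (a : E3 → E3) 2 (((volume : Measure E3).withDensity (fun x : E3 => ∑' k : ℕ, (ball (0 : E3) ((2 : ℝ) ^ k)).indicator (fun _ => ENNReal.ofReal ((4 : ℝ)⁻¹ ^ k / C)) x))) := Lp.memLp a
  set MU : ℝ≥0∞ := ∫⁻ x, (∑' k : ℕ, (ball (0 : E3) ((2 : ℝ) ^ k)).indicator (fun _ => ENNReal.ofReal ((4 : ℝ)⁻¹ ^ k / C)) x) * ‖(a : E3 → E3) x‖ₑ ^ 2 with hMUdef
  have hMU4 : MU ≤ 4 := by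
    rw [hMUdef, ← lintegral_weightedVolume₀ C (haU.aemeasurable.enorm.pow_const 2), ← eLpNorm_two_pow_two,
      ← Lp.enorm_def, ← ofReal_norm]
    calc ENNReal.ofReal ‖a‖ ^ 2 ≤ ENNReal.ofReal 2 ^ 2 := pow_le_pow_left' (ENNReal.ofReal_le_ofReal ha2) 2
      _ = 4 := by rw [ENNReal.ofReal_ofNat]; norm_num
  -- growth of the limit on balls
  have hgrowth : ∀ L : ℝ, 1 ≤ L → ∫⁻ x in ball (0 : E3) L, ‖(a : E3 → E3) x‖ₑ ^ 2 ≤ ENNReal.ofReal (16 * C * L ^ (2 : ℝ)) := by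
    intro L hL
    obtain ⟨K, hK1, hK2⟩ := exists_nat_pow_near hL one_lt_two
    set c : ℝ := (4 : ℝ)⁻¹ ^ (K + 1) / C with hc
    have hc0 : 0 < c := by positivity
    have hpt : ∀ x ∈ ball (0 : E3) ((2 : ℝ) ^ (K + 1)), ‖(a : E3 → E3) x‖ₑ ^ 2 ≤
        ENNReal.ofReal c⁻¹ * ((∑' k : ℕ, (ball (0 : E3) ((2 : ℝ) ^ k)).indicator (fun _ => ENNReal.ofReal ((4 : ℝ)⁻¹ ^ k / C)) x) * ‖(a : E3 → E3) x‖ₑ ^ 2) := by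
      intro x hx
      have hw := growthWeight_ge (C := C) (K + 1) hx
      rw [← hc] at hw
      calc ‖(a : E3 → E3) x‖ₑ ^ 2 = ENNReal.ofReal c⁻¹ * ENNReal.ofReal c * ‖(a : E3 → E3) x‖ₑ ^ 2 := by
            rw [← ENNReal.ofReal_mul (inv_nonneg.2 hc0.le), inv_mul_cancel₀ hc0.ne', ENNReal.ofReal_one, one_mul]
        _ ≤ ENNReal.ofReal c⁻¹ * (∑' k : ℕ, (ball (0 : E3) ((2 : ℝ) ^ k)).indicator (fun _ => ENNReal.ofReal ((4 : ℝ)⁻¹ ^ k / C)) x) * ‖(a : E3 → E3) x‖ₑ ^ 2 :=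
            mul_le_mul' (mul_le_mul' le_rfl hw) le_rfl
        _ = ENNReal.ofReal c⁻¹ * ((∑' k : ℕ, (ball (0 : E3) ((2 : ℝ) ^ k)).indicator (fun _ => ENNReal.ofReal ((4 : ℝ)⁻¹ ^ k / C)) x) * ‖(a : E3 → E3) x‖ₑ ^ 2) := mul_assoc _ _ _
    have hsub : ball (0 : E3) L ⊆ ball (0 : E3) ((2 : ℝ) ^ (K + 1)) := ball_subset_ball hK2.le
    calc ∫⁻ x in ball (0 : E3) L, ‖(a : E3 → E3) x‖ₑ ^ 2
        ≤ ∫⁻ x in ball (0 : E3) ((2 : ℝ) ^ (K + 1)), ‖(a : E3 → E3) x‖ₑ ^ 2 := lintegral_mono_set hsub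
      _ ≤ ∫⁻ x in ball (0 : E3) ((2 : ℝ) ^ (K + 1)), ENNReal.ofReal c⁻¹ * ((∑' k : ℕ, (ball (0 : E3) ((2 : ℝ) ^ k)).indicator (fun _ => ENNReal.ofReal ((4 : ℝ)⁻¹ ^ k / C)) x) * ‖(a : E3 → E3) x‖ₑ ^ 2) :=
          setLIntegral_mono' measurableSet_ball fun x hx => hpt x hx
      _ ≤ ∫⁻ x, ENNReal.ofReal c⁻¹ * ((∑' k : ℕ, (ball (0 : E3) ((2 : ℝ) ^ k)).indicator (fun _ => ENNReal.ofReal ((4 : ℝ)⁻¹ ^ k / C)) x) * ‖(a : E3 → E3) x‖ₑ ^ 2) := setLIntegral_le_lintegral _ _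
      _ = ENNReal.ofReal c⁻¹ * MU := by rw [lintegral_const_mul' _ _ ENNReal.ofReal_ne_top]
      _ ≤ ENNReal.ofReal c⁻¹ * 4 := mul_le_mul' le_rfl hMU4
      _ = ENNReal.ofReal (c⁻¹ * 4) := by rw [ENNReal.ofReal_mul (inv_nonneg.2 hc0.le), ENNReal.ofReal_ofNat]
      _ ≤ ENNReal.ofReal (16 * C * L ^ (2 : ℝ)) := by
          refine ENNReal.ofReal_le_ofReal ?_
          rw [hc, inv_div, Real.rpow_two, inv_pow, div_inv_eq_mul, pow_succ]
          have h4 : (4 : ℝ) ^ K = ((2 : ℝ) ^ K) ^ 2 := by rw [← pow_mul, mul_comm, pow_mul]; norm_num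
          rw [h4]
          have : ((2 : ℝ) ^ K) ^ 2 ≤ L ^ 2 := pow_le_pow_left₀ (by positivity) hK1 2
          nlinarith
  have hfin : ∀ R : ℝ, ∫⁻ x in ball (0 : E3) R, ‖(a : E3 → E3) x‖ₑ ^ 2 < ⊤ := by
    intro R
    have h := hgrowth (max R 1) (le_max_right _ _)
    exact lt_of_le_of_lt ((lintegral_mono_set (ball_subset_ball (le_max_left _ _))).trans h) ENNReal.ofReal_lt_top
  refine ⟨a, ns, hns, haU, locallyIntegrable_of_lintegral_ball_sq_lt_top haU hfin, hgrowth, ?_⟩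
  -- pairings
  intro Φ hΦ hΦc
  obtain ⟨CΦ, hCΦ⟩ := hΦ.bounded_above_of_compact_support hΦc
  obtain ⟨K, hK⟩ : ∃ K : ℕ, tsupport Φ ⊆ ball (0 : E3) ((2 : ℝ) ^ K) := by
    obtain ⟨r, hr⟩ := (hΦc.isCompact.isBounded).subset_ball (0 : E3)
    obtain ⟨K, hK⟩ := pow_unbounded_of_one_lt r (one_lt_two (α := ℝ))
    exact ⟨K, hr.trans (ball_subset_ball hK.le)⟩
  have hsupp : ∀ x, x ∉ ball (0 : E3) ((2 : ℝ) ^ K) → Φ x = 0 := fun x hx =>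
    image_eq_zero_of_notMem_tsupport fun h => hx (hK h)
  have hΦ2 : ∫⁻ x in ball (0 : E3) ((2 : ℝ) ^ K), ‖Φ x‖ₑ ^ 2 < ⊤ := by
    have hpt : ∀ x, ‖Φ x‖ₑ ^ 2 ≤ ENNReal.ofReal (CΦ ^ 2) := fun x => by
      rw [← ofReal_norm, ← ENNReal.ofReal_pow (norm_nonneg _)]
      exact ENNReal.ofReal_le_ofReal (pow_le_pow_left₀ (norm_nonneg _) (hCΦ x) 2)
    refine lt_of_le_of_lt (lintegral_mono fun x => hpt x) ?_
    rw [setLIntegral_const]; exact ENNReal.mul_lt_top ENNReal.ofReal_lt_top measure_ball_lt_top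
  have hg : MemLp (fun x => ((∑' k : ℕ, (ball (0 : E3) ((2 : ℝ) ^ k)).indicator (fun _ => ENNReal.ofReal ((4 : ℝ)⁻¹ ^ k / C)) x)).toReal⁻¹ • Φ x) 2 (((volume : Measure E3).withDensity (fun x : E3 => ∑' k : ℕ, (ball (0 : E3) ((2 : ℝ) ^ k)).indicator (fun _ => ENNReal.ofReal ((4 : ℝ)⁻¹ ^ k / C)) x))) :=
    memLp_invWeight_smul hC hΦ.aestronglyMeasurable K hsupp hΦ2
  -- every pairing with `toLp (w⁻¹Φ)` is the plain pairing with `Φ`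
  have hid : ∀ {f : E3 → E3} (hf : MemLp f 2 (((volume : Measure E3).withDensity (fun x : E3 => ∑' k : ℕ, (ball (0 : E3) ((2 : ℝ) ^ k)).indicator (fun _ => ENNReal.ofReal ((4 : ℝ)⁻¹ ^ k / C)) x)))),
      ⟪hf.toLp f, hg.toLp _⟫_ℝ = ∫ x, ⟪f x, Φ x⟫_ℝ := by
    intro f hf
    rw [inner_toLp_weightedVolume hC hf hg]
    refine integral_congr_ae (Eventually.of_forall fun x => ?_)
    exact weight_mul_inner_invWeight_smul hC f Φ x
  have h := hlim (hg.toLp _)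
  have ha : ⟪a, hg.toLp _⟫_ℝ = ∫ x, ⟪(a : E3 → E3) x, Φ x⟫_ℝ := by
    rw [← hid haM, Lp.toLp_coeFn]
  rw [ha] at h
  refine h.congr fun j => ?_
  exact hid (hmem (ns j)).1

end ExtremiserLiouville

end Summit.NavierStokesRegularity.NavierStokesRegularity.Theorems

end
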